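import Mathlib

/-!
# The corner-band energy lemma: algebraic core (kernel #224, lemmaR-A5 §28)

Solo-blind programme, session s89.  In the leaf-aligned chain at cross-leaf tilt `κ > 0` the
retained roll amplitude `u = r_1` (bare rate `α`) is coupled to the roll chain `y = (r_m)_{m≥2}`
by an injection bond of weight `δ(t) > 0` (into `r_2`) and a read-out bond of weight `B_1 = 3/2`
(from `r_2`), both carried by the fast factor `-iσ|h|P`.  With the Arnold-normalised energy
`E_w = |u|² + (B_1/δ) ‖y‖²` one has the exact identity
  `dE_w/dt = 2α|u|² - (B_1/δ) [ 2⟨y, (K_0(m²+κg) - c_m² a) y⟩ + (δ'/δ) ‖y‖² ]`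
because the two bond terms cancel (detailed balance `δ : B_1`, kernel #222) and `⟨y, Jy⟩` is real.
Every chain mode out-decays `u` by `2K_0(m² - 1) ≥ 6K_0`, so if `-d ln δ/dt ≤ 6K_0 - 2|a|κg` along the
leaf, `e^{-2∫α} E_w` is non-increasing and the dressed slow resolvent is dominated by the bare one
with constant ONE.  This file proves the algebra:

* `bond_cancel` — the cancellation of the injection/read-out cross terms for complex amplitudes;
* `cfactor_diff`, `cfactor_diff_abs_le` — `c_1² - c_m² = -x(m²-1)/((1+x)(m²+x))`, `|·| ≤ x`;
* `mode_dissipation` — the per-mode rate inequality under the leaf hypothesis;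
* `logA2_hasDerivAt`, `dlogA2_pos`, `dlogA2_le_one` — `d ln A_2/d ln x ∈ (0, 1]`, so
  `|d ln δ/dt| ≤ |d ln g/dt|` (the hypothesis is a leaf inequality on `g` alone);
* `u16r_leaf_inequality` — the recorded U16r cusp-leaf numbers `1.2982 < 6 K_0 = 1.4112`.
-/

namespace Summit.AnomalousDissipation.AnomalousDissipation.Theorems

open Complex in
/-- BOND CANCELLATION.  For complex amplitudes `u, y`, real `σ, B` and `δ ≠ 0`:
`2 Re(ū · (-iσB y)) + (B/δ) · 2 Re(ȳ · (-iσδ u)) = 0` — the injection and read-out terms of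
`dE_w/dt` cancel exactly when the weights are in the detailed-balance ratio `δ : B`. -/
theorem bond_cancel (u y : ℂ) (σ B δ : ℝ) (hδ : δ ≠ 0) :
    2 * ((starRingEnd ℂ) u * (-I * σ * B * y)).re
      + B / δ * (2 * ((starRingEnd ℂ) y * (-I * σ * δ * u)).re) = 0 := by
  simp only [mul_re, mul_im, neg_re, neg_im, I_re, I_im, ofReal_re, ofReal_im,
    conj_re, conj_im]
  field_simp
  ring

/-- The tilt factors `c_m² = m²/(m² + x)` (`x = κ g ≥ 0`): `c_1² - c_m² = -x(m²-1)/((1+x)(m²+x))`. -/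
theorem cfactor_diff (msq x : ℝ) (hx : 0 ≤ x) (hm : 1 ≤ msq) :
    1 / (1 + x) - msq / (msq + x) = -(x * (msq - 1)) / ((1 + x) * (msq + x)) := by
  have h1 : (1 + x) ≠ 0 := (by linarith : (0:ℝ) < 1 + x).ne'
  have h2 : (msq + x) ≠ 0 := (by linarith : (0:ℝ) < msq + x).ne'
  field_simp
  ring

/-- and `|c_1² - c_m²| ≤ x`. -/
theorem cfactor_diff_abs_le (msq x : ℝ) (hx : 0 ≤ x) (hm : 1 ≤ msq) :
    |1 / (1 + x) - msq / (msq + x)| ≤ x := by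
  rw [cfactor_diff msq x hx hm]
  have h1 : 0 < 1 + x := by positivity
  have h2 : 0 < msq + x := by positivity
  have hnum : 0 ≤ x * (msq - 1) := mul_nonneg hx (by linarith)
  rw [neg_div, abs_neg, abs_of_nonneg (div_nonneg hnum (by positivity))]
  rw [div_le_iff₀ (by positivity)]
  nlinarith [mul_nonneg hx hx, mul_nonneg hx (by linarith : (0:ℝ) ≤ msq - 1),
    mul_nonneg (mul_nonneg hx hx) (by linarith : (0:ℝ) ≤ msq - 1)]

/-- PER-MODE DISSIPATION.  For a chain mode with `m² ≥ 4`, viscosity `K_0 > 0`, strain rate `a`,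
tilt `x = κg ≥ 0`, c-factor difference `e = c_1² - c_m²` with `|e| ≤ x`, and weight log-derivative `d`
satisfying the leaf hypothesis `d ≥ -(6K_0 - 2|a|x)`, the mode's rate in `d(e^{-2∫α}E_w)/dt` is
non-negative: `2K_0(m² - 1) + 2 a e + d ≥ 0`. -/
theorem mode_dissipation (K₀ a x e d msq : ℝ) (hK : 0 < K₀) (hm : 4 ≤ msq)
    (he : |e| ≤ x) (hd : -(6 * K₀ - 2 * |a| * x) ≤ d) :
    0 ≤ 2 * K₀ * (msq - 1) + 2 * a * e + d := by
  have h1 : 6 * K₀ ≤ 2 * K₀ * (msq - 1) := by nlinarith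
  have h2 : -(2 * |a| * x) ≤ 2 * a * e := by
    have hae : |a * e| ≤ |a| * x := by
      rw [abs_mul]; exact mul_le_mul_of_nonneg_left he (abs_nonneg a)
    have := neg_abs_le (a * e)
    linarith
  linarith

/-- `ln A_2 = ln x - ½ ln(1+x) - ½ ln(4+x)` has derivative `1/x - 1/(2(1+x)) - 1/(2(4+x))` at `x > 0`
(so `d ln A_2 / d ln x = 1 - x/(2(1+x)) - x/(2(4+x))`). -/
theorem logA2_hasDerivAt (x : ℝ) (hx : 0 < x) :
    HasDerivAt (fun x => Real.log x - 1 / 2 * Real.log (1 + x) - 1 / 2 * Real.log (4 + x))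
      (1 / x - 1 / (2 * (1 + x)) - 1 / (2 * (4 + x))) x := by
  have h0 : HasDerivAt (fun x => Real.log x) (1 / x) x := by
    simpa [one_div] using Real.hasDerivAt_log hx.ne'
  have h1 : HasDerivAt (fun x => Real.log (1 + x)) (1 / (1 + x)) x := by
    have := ((hasDerivAt_id x).const_add 1).log (by positivity)
    simpa [one_div] using this
  have h4 : HasDerivAt (fun x => Real.log (4 + x)) (1 / (4 + x)) x := by
    have := ((hasDerivAt_id x).const_add 4).log (by positivity)
    simpa [one_div] using this
  have hall := (h0.sub (h1.const_mul (1 / 2))).sub (h4.const_mul (1 / 2))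
  have hfun : (fun x : ℝ => Real.log x - 1 / 2 * Real.log (1 + x) - 1 / 2 * Real.log (4 + x))
      = (((fun x : ℝ => Real.log x) - fun x : ℝ => 1 / 2 * Real.log (1 + x))
          - fun x : ℝ => 1 / 2 * Real.log (4 + x)) := by
    funext z; simp
  rw [hfun]
  refine hall.congr_deriv ?_
  have hx1 : (1 + x) ≠ 0 := by positivity
  have hx4 : (4 + x) ≠ 0 := by positivity
  field_simp

/-- The log-log slope of `A_2`: `φ(x) = 1 - x/(2(1+x)) - x/(2(4+x))`. -/
noncomputable def dlogA2 (x : ℝ) : ℝ := 1 - x / (2 * (1 + x)) - x / (2 * (4 + x))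

/-- `x · (d/dx ln A_2) = φ(x)`. -/
theorem dlogA2_eq (x : ℝ) (hx : 0 < x) :
    x * (1 / x - 1 / (2 * (1 + x)) - 1 / (2 * (4 + x))) = dlogA2 x := by
  unfold dlogA2
  have h1 : (1 + x) ≠ 0 := by positivity
  have h4 : (4 + x) ≠ 0 := by positivity
  have hx0 : x ≠ 0 := hx.ne'
  field_simp

/-- `φ(x) > 0` for `x ≥ 0`: the de-rating `δ = A_2(κ g)` increases with `g`. -/
theorem dlogA2_pos (x : ℝ) (hx : 0 ≤ x) : 0 < dlogA2 x := by
  unfold dlogA2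
  have h1 : 0 < 1 + x := by positivity
  have h4 : 0 < 4 + x := by positivity
  have e1 : x / (2 * (1 + x)) < 1 / 2 := by
    rw [div_lt_iff₀ (by positivity)]; linarith
  have e4 : x / (2 * (4 + x)) < 1 / 2 := by
    rw [div_lt_iff₀ (by positivity)]; linarith
  linarith

/-- `φ(x) ≤ 1` for `x ≥ 0`: `|d ln δ/dt| ≤ |d ln g/dt|` — the energy-lemma hypothesis on `δ` follows
from the same inequality on the leaf metric factor `g`. -/
theorem dlogA2_le_one (x : ℝ) (hx : 0 ≤ x) : dlogA2 x ≤ 1 := by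
  unfold dlogA2
  have e1 : 0 ≤ x / (2 * (1 + x)) := by positivity
  have e4 : 0 ≤ x / (2 * (4 + x)) := by positivity
  linarith

/-- THE U16r LEAF INEQUALITY (recorded float constants, leaf_pure.py NX = 2880): the maximal descent
rate of `ln g` along the cusp leaf, `1.2982`, is below `6 K_0 = 6 × 0.23519757`, with margin `> 0.11`. -/
theorem u16r_leaf_inequality :
    (1.2982 : ℝ) < 6 * 0.23519757 ∧ 6 * (0.23519757 : ℝ) - 1.2982 > 0.11 := by
  constructor <;> norm_num

/-- ENERGY MONOTONICITY ⇒ RESOLVENT BOUND (the one-line conclusion): if `Ẽ(t) ≤ Ẽ(t')`, where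
`Ẽ = e^{-2A} E_w` with `E_w ≥ |u|²` and `E_w(t') = |u(t')|²` (`A = ∫_{t'}^{t} α`), then
`|u(t)|² ≤ e^{2A} |u(t')|²`. -/
theorem resolvent_bound_of_energy (Ew_t Ew_t' usq_t usq_t' A : ℝ)
    (hmono : Real.exp (-2 * A) * Ew_t ≤ Ew_t') (hinit : Ew_t' = usq_t') (hdom : usq_t ≤ Ew_t) :
    usq_t ≤ Real.exp (2 * A) * usq_t' := by
  have hpos : 0 < Real.exp (2 * A) := Real.exp_pos _
  have key : Real.exp (2 * A) * (Real.exp (-2 * A) * Ew_t) = Ew_t := by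
    rw [← mul_assoc, ← Real.exp_add]; norm_num
  have h1 : Ew_t ≤ Real.exp (2 * A) * Ew_t' := by
    have := mul_le_mul_of_nonneg_left hmono hpos.le
    rwa [key] at this
  rw [← hinit]
  linarith

end Summit.AnomalousDissipation.AnomalousDissipation.Theorems
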